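import Summits.HodgeConjecture.CorCM.IrreducibleOddWeightsIndexParityTwisted
import HarnessLib

/-!
# Index parity, V (CM fields): TOTAL ABSORPTION — if `y₀(T)` contains the Galois closure of `K₁` and `[K₀ : T]` is even,
# the fibre-twisted type `Φ^{(y₀)}` of `K₀` satisfies `dim MT(A^{(y₀)} × A₁) = dim MT(A^{(y₀)})` for EVERY CM type of `K₁`;
# MONOTONE DEFECT SPECTRA across fields over the same `T` (additivity descends along the parity class of the index)

COR-CM (cell `pub-hodgecm2`, binder seat `b16` gen 68, count-neutral claim INDEX PARITY, file P4; theorems only, no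
definition, no named fact, no `sorry`).  NEW as stated, hence under `Summits/`.  HONEST FRAMING: Galois theory of CM
fields inside `ℂ` and finite combinatorics of CM types with consequences for `dim MT(A₀ × A₁)` of abelian varieties with
complex multiplication; nothing is claimed about the algebraicity of Hodge classes; `HC_CM` is neither used nor asserted.

SETTING (files P1–P3 `IrreducibleOddWeightsIndexParity{,Shadows,CMFields,Twisted}`).  `T ⊆ K_{i₀}` a subfield with an
embedding `y₀ : T → ℂ` such that `y₀(T) ⊇ L₁ = normalClosure ℚ K_{i₁} ℂ`; `Φ_{i₀}` a CM type of `K_{i₀}` with the TWISTED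
SHADOW `[K_{i₀}:T]·(δ_{y₀} − δ_{ȳ₀})` on `Hom(T, ℂ)` (it exists whenever `[K_{i₀}:T]` is even, P3
`exists_cmType_twisted_shadow`).

* `trace_le_of_normalClosure_le_range` — `y₀(T) ⊇ L₁` implies (TR): `L₁` is normal, hence inside `y(T)` for EVERY
  embedding `y` of `T`, so `a(k) ∈ L₁ ⟹ k ∈ T`.
* `apply_mul_eq_of_mem_span_coeff_of_normalClosure_le_range` — an automorphism of `ℂ` fixing `y₀` fixes every embedding
  of `K_{i₁}`: every matrix coefficient of slot `i₁` is LEFT-INVARIANT under `Aut(ℂ/y₀T)`.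
* **`cmFamilyRank_eq_cmTypeRank_of_twisted_shadow`** — hence (P3 `mem_twistedShadowCoeff_inf_iff`, P2 defect formula)
  the defect space is ALL of `MC₁` and **`cmFamilyRank Φ = cmTypeRank Φ_{i₀}`: `dim MT(A^{(y₀)} × A₁) = dim MT(A^{(y₀)})`
  for EVERY CM type `Φ_{i₁}` of `K_{i₁}`**; existence form **`exists_cmType_forall_cmFamilyRank_eq`** (`[K_{i₀}:T]` even,
  `T` without real embeddings): ONE CM type of `K_{i₀}` whose Mumford–Tate group dominates those of ALL abelian
  varieties with complex multiplication by `K_{i₁}` — the pair is never additive, the defect is the whole of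
  `dim Hg(A₁) ≥ 1` (compare the Serre group of `T`, of dimension `[T:ℚ]/2 + 1`, which surjects onto every such `MT(A₁)`);
  Hodge side `exists_not_hodgeClassesProductSpan_of_twisted_shadow` (mixed exceptional classes on some `A₀^a × A₁^b` for
  EVERY partner type and every pair of realisations).

* §4 **MONOTONE DEFECT SPECTRA ACROSS FIELDS** (the corollaries announced in P2 §4, proved here):
  `exists_defect_eq_of_finrank_eq_add` — `[K_{i₀}:T] = [K′_{i₀}:T] + 2d`, same partner up to isomorphism, both
  (TR) ⟹ every defect of a type of `K′_{i₀}` is the defect of a type of `K_{i₀}`;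
  `forall_additive_of_forall_additive_of_finrank_eq_add` — `Hg(A₀ × A₁) = Hg(A₀) × Hg(A₁)` for all types of `K_{i₀}`
  forces it for all types of `K′_{i₀}`: additivity DESCENDS along the parity class of the index over `T`.

## References

* [Gordon1999HodgeAVSurvey] B. B. Gordon, *A survey of the Hodge conjecture for abelian varieties*, §3 Theorem (proof),
  7.5–7.7, 9.4.3.
* [Dodson1987] B. Dodson, J. Algebra 111 (1987), §1.1 (lifts of types).
* [Lang2002] S. Lang, *Algebra*, 3rd ed., V §2 Thm. 2.8, VI §1 Thm. 1.1, Thm. 1.12.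
* [Shimura1998] G. Shimura, *Abelian Varieties with Complex Multiplication and Modular Functions*, §8.1, §18.1.
* [Deligne1982HodgeCycles] P. Deligne, *Hodge cycles on abelian varieties*, LNM 900, I.3.4, I Ex. 3.7 (c).
* [MoonenZarhin1999LowDim] B. Moonen, Yu. Zarhin, Math. Ann. 315 (1999), §3 (3.1).
-/

set_option autoImplicit false

noncomputable section

open scoped BigOperators Classical

open CategoryTheory CategoryTheory.Limits NumberField Module IntermediateField

namespace Summit.HodgeConjecture.CorCM

open Literature.NumberTheory.ComplexMultiplication
open Literature.AlgebraicGeometry.Motives (AbelianVariety CMType)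
open Literature.AlgebraicGeometry.Motives.AbelianVariety
open Literature.AlgebraicGeometry.HodgeTheory
open Literature.AlgebraicGeometry.ComplexMultiplication (IsCMTypeRealisation)
open Literature.AlgebraicGeometry.Pohlmann1968

/-! ### §3 Total absorption: `y₀(T) ⊇ L₁` -/

section Absorption

variable {I : Type} [Fintype I] {K : I → Type} [∀ i, Field (K i)] [∀ i, NumberField (K i)] [∀ i, IsCMField (K i)]
  {T : Type} [Field T] [NumberField T]

omit [Fintype I] [∀ i, IsCMField (K i)] in
/-- **`y₀(T) ⊇ L₁` implies (TR)**: `L₁` is normal, so it lies in `y(T)` for EVERY embedding `y` of `T`; hence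
`a(k) ∈ L₁ ⟹ k ∈ T`. [cite: Lang2002, V §2 Thm. 2.8 and VI §1 Thm. 1.12] -/
theorem trace_le_of_normalClosure_le_range {i₀ : I} (i₁ : I) [Algebra T (K i₀)] (y₀ : T →+* ℂ)
    (hL : ∀ z : ℂ, z ∈ normalClosure ℚ (K i₁) ℂ → z ∈ Set.range y₀) (a : K i₀ →+* ℂ) (k : K i₀)
    (hk : a k ∈ normalClosure ℚ (K i₁) ℂ) : k ∈ Set.range (algebraMap T (K i₀)) := by
  haveI := isPretransitive_ringEquiv_complex (K := T)
  obtain ⟨g, hg⟩ := MulAction.exists_smul_eq (ℂ ≃+* ℂ) y₀ (a.comp (algebraMap T (K i₀)))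
  obtain ⟨t, ht⟩ := hL _ (ringEquiv_apply_mem_normalClosure i₁ g⁻¹ hk)
  refine ⟨t, a.injective ?_⟩
  have h1 : (g • y₀) t = a k := by
    rw [ringEquiv_smul_apply, ht]
    exact RingEquiv.apply_symm_apply g (a k)
  rw [hg] at h1
  exact h1

omit [Fintype I] [∀ i, IsCMField (K i)] [NumberField T] in
/-- `y₀(T) ⊇ L₁`: an automorphism fixing `y₀` fixes every embedding of `K_{i₁}`, so every matrix coefficient of slot
`i₁` is left-invariant under `Aut(ℂ/y₀T)`. [cite: Lang2002, V §2 Thm. 2.8] [cite: Shimura1998, §8.1] -/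
theorem apply_mul_eq_of_mem_span_coeff_of_normalClosure_le_range {i₁ : I} (y₀ : T →+* ℂ)
    (hL : ∀ z : ℂ, z ∈ normalClosure ℚ (K i₁) ℂ → z ∈ Set.range y₀) (Φ₁ : CMType (K i₁)) {c : (ℂ ≃+* ℂ) → ℚ}
    (hc : c ∈ Submodule.span ℚ (Set.range fun x : K i₁ →+* ℂ => fun g : ℂ ≃+* ℂ => antiVec Φ₁.1 g x))
    {h : ℂ ≃+* ℂ} (hh : h • y₀ = y₀) (g : ℂ ≃+* ℂ) : c (h * g) = c g := by
  -- `h` fixes every embedding of `K_{i₁}`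
  have hfix : ∀ x : K i₁ →+* ℂ, h • x = x := by
    intro x
    refine RingHom.ext fun k => ?_
    obtain ⟨t, ht⟩ := hL _ (apply_mem_normalClosure i₁ x k)
    rw [ringEquiv_smul_apply, ← ht]
    have := RingHom.congr_fun hh t
    rwa [ringEquiv_smul_apply] at this
  induction hc using Submodule.span_induction generalizing g with
  | mem c hc =>
    obtain ⟨x, rfl⟩ := hc
    simp only [antiVec, translateInd, mul_smul, hfix]
  | zero => simp
  | add c c' _ _ hc hc' => rw [Pi.add_apply, Pi.add_apply, hc, hc']
  | smul a c _ hc => rw [Pi.smul_apply, Pi.smul_apply, hc]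

/-- **TOTAL ABSORPTION**: if `T ⊆ K_{i₀}` has an embedding `y₀` with `y₀(T) ⊇ L₁`, and `Φ_{i₀}` is the twisted type at
`y₀` (shadow `[K_{i₀}:T]·(δ_{y₀} − δ_{ȳ₀})`), then **`cmFamilyRank Φ = cmTypeRank Φ_{i₀}`: `dim MT(A^{(y₀)} × A₁) =
dim MT(A^{(y₀)})` for EVERY CM type `Φ_{i₁}` of `K_{i₁}`** — the defect is all of `dim Hg(A₁)`.
[cite: Gordon1999HodgeAVSurvey, §3 Theorem, 7.5–7.7] [cite: Deligne1982HodgeCycles, I.3.4 and I Ex. 3.7 (c)] -/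
theorem cmFamilyRank_eq_cmTypeRank_of_twisted_shadow {i₀ i₁ : I} (h01 : i₀ ≠ i₁) (hI : ∀ l, l = i₀ ∨ l = i₁)
    (Φ : ∀ i, CMType (K i)) [Algebra T (K i₀)] (y₀ : T →+* ℂ)
    (hL : ∀ z : ℂ, z ∈ normalClosure ℚ (K i₁) ℂ → z ∈ Set.range y₀)
    (htw : ∀ y : T →+* ℂ,
      ∑ t ∈ Finset.univ.filter (fun t : K i₀ →+* ℂ => t.comp (algebraMap T (K i₀)) = y),
          antiVec (Φ i₀).1 (1 : ℂ ≃+* ℂ) t =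
        (Module.finrank T (K i₀) : ℚ) *
          ((if y = y₀ then 1 else 0) - (if y = (starRingAut : ℂ ≃+* ℂ) • y₀ then 1 else 0))) :
    CMAlgebra.cmFamilyRank Φ = cmTypeRank (Φ i₀) := by
  have h := cmTypeRank_add_cmTypeRank_eq_cmFamilyRank_add_one_add_finrank_shadow_inf h01 hI Φ
    (trace_le_of_normalClosure_le_range i₁ y₀ hL)
  -- the intersection is all of `MC₁`
  have hinf : Submodule.span ℚ (Set.range fun y : T →+* ℂ => fun g : ℂ ≃+* ℂ =>
          ∑ t ∈ Finset.univ.filter (fun t : K i₀ →+* ℂ => t.comp (algebraMap T (K i₀)) = g • y),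
            antiVec (Φ i₀).1 (1 : ℂ ≃+* ℂ) t) ⊓
        Submodule.span ℚ (Set.range fun x : K i₁ →+* ℂ => fun g : ℂ ≃+* ℂ => antiVec (Φ i₁).1 g x) =
      Submodule.span ℚ (Set.range fun x : K i₁ →+* ℂ => fun g : ℂ ≃+* ℂ => antiVec (Φ i₁).1 g x) := by
    refine le_antisymm inf_le_right fun c hc => ?_
    exact (mem_twistedShadowCoeff_inf_iff (Φ i₀) y₀ htw (Φ i₁) c).2
      ⟨hc, fun h hh g => apply_mul_eq_of_mem_span_coeff_of_normalClosure_le_range y₀ hL (Φ i₁) hc hh g⟩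
  rw [hinf] at h
  -- `cmTypeRank Φ₁ = dim MC₁ + 1`
  have hr : cmTypeRank (Φ i₁) = Module.finrank ℚ (Submodule.span ℚ
      (Set.range fun x : K i₁ →+* ℂ => fun g : ℂ ≃+* ℂ => antiVec (Φ i₁).1 g x)) + 1 := by
    change typeRank (ℂ ≃+* ℂ) (Φ i₁).1 = _
    rw [(isCMTypeWith_conj (Φ i₁)).typeRank_eq_finrank_antiSpan_add_one,
      IrrOdd.finrank_antiSpan_eq_finrank_span_coeff]
  omega

/-- **EXISTENCE FORM**: `[K_{i₀} : T]` even, `T` without real embeddings, `y₀(T) ⊇ L₁` ⟹ there is ONE CM type `Φ₀` of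
`K_{i₀}` such that `dim MT(A_{Φ₀} × A₁) = dim MT(A_{Φ₀})` for EVERY CM type `Φ₁` of `K_{i₁}` and every pair of
realisations: `Hg(A₁)` is a quotient of `Hg(A_{Φ₀})`, the defect is the whole of `dim Hg(A₁) ≥ 1`, and the pair is never
additive. [cite: Gordon1999HodgeAVSurvey, §3 Theorem, 7.5–7.7] [cite: Deligne1982HodgeCycles, I.3.4 and I Ex. 3.7 (c)] -/
theorem exists_cmType_forall_cmFamilyRank_eq {i₀ i₁ : I} (h01 : i₀ ≠ i₁) (hI : ∀ l, l = i₀ ∨ l = i₁)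
    [Algebra T (K i₀)] [IsTotallyComplex T] (heven : Even (Module.finrank T (K i₀))) (y₀ : T →+* ℂ)
    (hL : ∀ z : ℂ, z ∈ normalClosure ℚ (K i₁) ℂ → z ∈ Set.range y₀) :
    ∃ Φ₀ : CMType (K i₀), ∀ Φ : ∀ i, CMType (K i), Φ i₀ = Φ₀ →
      CMAlgebra.cmFamilyRank Φ = cmTypeRank (Φ i₀) ∧ CMAlgebra.cmFamilyRank Φ + 2 ≤ cmTypeRank (Φ i₀) + cmTypeRank (Φ i₁) := by
  obtain ⟨Φ₀, hΦ₀⟩ := exists_cmType_twisted_shadow (K₀ := K i₀) heven y₀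
  refine ⟨Φ₀, fun Φ hΦ => ?_⟩
  have h := cmFamilyRank_eq_cmTypeRank_of_twisted_shadow h01 hI Φ y₀ hL (by rw [hΦ]; exact hΦ₀)
  have h2 := two_le_cmTypeRank_of_cmType (Φ i₁)
  exact ⟨h, by omega⟩


variable {Φ : ∀ i, CMType (K i)} {A : I → AbelianVariety ℂ} {ιA : ∀ i, 𝓞 (K i) →+* End (A i)}
  {θ : ∀ i, K i →+* Module.End ℂ (complexBetti (A i).X 1)}

/-- **Hodge side of total absorption: MIXED EXCEPTIONAL CLASSES FOR EVERY PARTNER TYPE.**  Under the hypotheses of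
`cmFamilyRank_eq_cmTypeRank_of_twisted_shadow`, for every pair of realisations `A₀ ⊨ (K_{i₀}; Φ^{(y₀)})`,
`A₁ ⊨ (K_{i₁}; Φ_{i₁})` some product `A₀^a × A₁^b` carries a rational Hodge class which is NOT a `ℂ`-combination of exterior
products of rational Hodge classes of the two factors (the pair is not additive: defect `dim Hg(A₁) ≥ 1`).
[cite: Gordon1999HodgeAVSurvey, 7.5–7.7] [cite: MoonenZarhin1999LowDim, §3 (3.1)] -/
theorem exists_not_hodgeClassesProductSpan_of_twisted_shadow {i₀ i₁ : I} (h01 : i₀ ≠ i₁) (hI : ∀ l, l = i₀ ∨ l = i₁)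
    [Algebra T (K i₀)] (y₀ : T →+* ℂ) (hL : ∀ z : ℂ, z ∈ normalClosure ℚ (K i₁) ℂ → z ∈ Set.range y₀)
    (htw : ∀ y : T →+* ℂ,
      ∑ t ∈ Finset.univ.filter (fun t : K i₀ →+* ℂ => t.comp (algebraMap T (K i₀)) = y),
          antiVec (Φ i₀).1 (1 : ℂ ≃+* ℂ) t =
        (Module.finrank T (K i₀) : ℚ) *
          ((if y = y₀ then 1 else 0) - (if y = (starRingAut : ℂ ≃+* ℂ) • y₀ then 1 else 0)))
    (hA : ∀ i, IsCMTypeRealisation (Φ i) (A i) (ιA i) (θ i)) :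
    ∃ (N₁ N₂ : ℕ) (_ : NeZero N₁) (_ : NeZero N₂) (π₁ : Fin N₁ → I) (π₂ : Fin N₂ → I),
      (∀ j₁ j₂, π₁ j₁ ≠ π₂ j₂) ∧ ¬ HodgeClassesProductSpan (⨁ fun j => A (π₁ j)) (⨁ fun j => A (π₂ j)) := by
  classical
  haveI : Nonempty I := ⟨i₀⟩
  refine exists_not_hodgeClassesProductSpan_of_cmFamilyRank_add_card_ne hA ?_
  have h := cmFamilyRank_eq_cmTypeRank_of_twisted_shadow h01 hI Φ y₀ hL htw
  have h2 := two_le_cmTypeRank_of_cmType (Φ i₁)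
  have hcard : Fintype.card I = 2 := by
    rw [← Finset.card_univ, show (Finset.univ : Finset I) = {i₀, i₁} from Finset.ext fun j => by
      simpa only [Finset.mem_univ, Finset.mem_insert, Finset.mem_singleton, true_iff] using hI j,
      Finset.card_pair h01]
  rw [IrrOdd.sum_eq_add_of_pair _ hI h01, hcard]
  omega

end Absorption

/-! ### §4 Monotone defect spectra across fields (the corollaries announced in P2 §4) -/

section Monotone

variable {I : Type} [Fintype I] {K : I → Type} [∀ i, Field (K i)] [∀ i, NumberField (K i)] [∀ i, IsCMField (K i)]
  {K' : I → Type} [∀ i, Field (K' i)] [∀ i, NumberField (K' i)] [∀ i, IsCMField (K' i)]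
  {T : Type} [Field T] [NumberField T]

/-- **MONOTONE DEFECT SPECTRA**: two pairs of CM fields `(K_{i₀}, K_{i₁})`, `(K′_{i₀}, K′_{i₁})` with `K′_{i₁} ≅ K_{i₁}`
(corresponding partner types), a common subfield `T` without real embeddings of `K_{i₀}` and `K′_{i₀}` containing both
traces (TR), and **`[K_{i₀} : T] = [K′_{i₀} : T] + 2d`**.  Then EVERY defect realised by a type of `K′_{i₀}` is realised
by a type of `K_{i₀}`: for every `Φ′` there is `Φ₀` with
`cmTypeRank Φ₀ + cmFamilyRank Φ′ = cmTypeRank Φ′_{i₀} + cmFamilyRank (Φ with slot i₀ replaced by Φ₀)`.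
[cite: Gordon1999HodgeAVSurvey, §3 Theorem, 7.5–7.7 and 9.4.3] [cite: Dodson1987, §1.1] -/
theorem exists_defect_eq_of_finrank_eq_add {i₀ i₁ : I} (h01 : i₀ ≠ i₁) (hI : ∀ l, l = i₀ ∨ l = i₁)
    (Φ : ∀ i, CMType (K i)) (Φ' : ∀ i, CMType (K' i)) [Algebra T (K i₀)] [Algebra T (K' i₀)] [IsTotallyComplex T]
    (e : K' i₁ ≃+* K i₁) (hΦ₁ : ∀ t : K i₁ →+* ℂ, t ∈ (Φ i₁).1 ↔ t.comp e.toRingHom ∈ (Φ' i₁).1)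
    (htr : ∀ (a : K i₀ →+* ℂ) (k : K i₀), a k ∈ normalClosure ℚ (K i₁) ℂ → k ∈ Set.range (algebraMap T (K i₀)))
    (htr' : ∀ (a : K' i₀ →+* ℂ) (k : K' i₀), a k ∈ normalClosure ℚ (K' i₁) ℂ →
      k ∈ Set.range (algebraMap T (K' i₀)))
    {d : ℕ} (hd : Module.finrank T (K i₀) = Module.finrank T (K' i₀) + 2 * d) :
    ∃ Φ₀ : CMType (K i₀), cmTypeRank Φ₀ + CMAlgebra.cmFamilyRank Φ' =
      cmTypeRank (Φ' i₀) + CMAlgebra.cmFamilyRank (Function.update Φ i₀ Φ₀) := by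
  obtain ⟨Φ₀, hΦ₀⟩ := exists_cmType_shadow_eq_of_finrank_eq_add (K₀ := K i₀) (Φ' i₀) hd
  refine ⟨Φ₀, ?_⟩
  have h := cmTypeRank_add_cmFamilyRank_eq_of_shadow_eq_of_ringEquiv h01 hI (Function.update Φ i₀ Φ₀) Φ' e
    (by rw [Function.update_of_ne h01.symm]; exact hΦ₁) htr htr'
    (by rw [Function.update_self]; exact hΦ₀)
  rw [Function.update_self] at h
  exact h

/-- **ADDITIVITY FOR ALL TYPES DESCENDS ALONG THE PARITY CLASS OF THE INDEX**: in the situation above, if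
`Hg(A₀ × A₁) = Hg(A₀) × Hg(A₁)` for EVERY CM type of `K_{i₀}` against the partner type, then also for every CM type of
`K′_{i₀}` (`[K′_{i₀} : T] ≤ [K_{i₀} : T]` of the same parity) against the corresponding partner type.
[cite: Gordon1999HodgeAVSurvey, §3 Theorem, 7.5–7.7 and 9.4.3] [cite: Dodson1987, §1.1] -/
theorem forall_additive_of_forall_additive_of_finrank_eq_add {i₀ i₁ : I} (h01 : i₀ ≠ i₁) (hI : ∀ l, l = i₀ ∨ l = i₁)
    (Φ : ∀ i, CMType (K i)) (Φ' : ∀ i, CMType (K' i)) [Algebra T (K i₀)] [Algebra T (K' i₀)] [IsTotallyComplex T]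
    (e : K' i₁ ≃+* K i₁) (hΦ₁ : ∀ t : K i₁ →+* ℂ, t ∈ (Φ i₁).1 ↔ t.comp e.toRingHom ∈ (Φ' i₁).1)
    (htr : ∀ (a : K i₀ →+* ℂ) (k : K i₀), a k ∈ normalClosure ℚ (K i₁) ℂ → k ∈ Set.range (algebraMap T (K i₀)))
    (htr' : ∀ (a : K' i₀ →+* ℂ) (k : K' i₀), a k ∈ normalClosure ℚ (K' i₁) ℂ →
      k ∈ Set.range (algebraMap T (K' i₀)))
    {d : ℕ} (hd : Module.finrank T (K i₀) = Module.finrank T (K' i₀) + 2 * d)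
    (hAA : ∀ Φ₀ : CMType (K i₀), CMAlgebra.cmFamilyRank (Function.update Φ i₀ Φ₀) + Fintype.card I =
      (∑ i, cmTypeRank (Function.update Φ i₀ Φ₀ i)) + 1) :
    CMAlgebra.cmFamilyRank Φ' + Fintype.card I = (∑ i, cmTypeRank (Φ' i)) + 1 := by
  obtain ⟨Φ₀, h⟩ := exists_defect_eq_of_finrank_eq_add h01 hI Φ Φ' e hΦ₁ htr htr' hd
  have hA := hAA Φ₀
  rw [IrrOdd.sum_eq_add_of_pair _ hI h01, Function.update_self, Function.update_of_ne h01.symm] at hA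
  rw [IrrOdd.sum_eq_add_of_pair _ hI h01]
  -- the partner ranks agree
  have hr : cmTypeRank (Φ' i₁) = cmTypeRank (Φ i₁) := by
    change typeRank (ℂ ≃+* ℂ) (Φ' i₁).1 = typeRank (ℂ ≃+* ℂ) (Φ i₁).1
    rw [(isCMTypeWith_conj (Φ' i₁)).typeRank_eq_finrank_antiSpan_add_one,
      (isCMTypeWith_conj (Φ i₁)).typeRank_eq_finrank_antiSpan_add_one,
      IrrOdd.finrank_antiSpan_eq_finrank_span_coeff, IrrOdd.finrank_antiSpan_eq_finrank_span_coeff,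
      span_coeff_eq_of_ringEquiv e (Φ i₁) (Φ' i₁) hΦ₁]
  omega

end Monotone

end Summit.HodgeConjecture.CorCM

end
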